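import Literature.NumberTheory.Automorphic.QuaternionSubidealCount
import HarnessLib

/-!
# Principal ideals of a local quaternion order, counted through units modulo `p ^ R`

Topic `NumberTheory/Automorphic`; one small definition (`normLevelUnits`, the set `X_k` of units of
`B` in `Λ = O_(p)` generating a principal right ideal of index `p^{2k}`), otherwise theorems; no
named fact, no instance. This is the uniform "local factor" computation of Eichler's mass formula
in its unit-index form (Voight, *Quaternion Algebras*, §26.4 and Lemma 26.6.7 / Körner 1987 §3:
the Euler factor of `ζ_O(s) = ∑_{M ⊆ O} [O : M]^{-s}` at `p` is governed by `[O'ˣ_p : Oˣ_p]`,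
computed through `(O/pO)ˣ`): instead of counting principal right ideals of each local model
separately, we express, for an arbitrary `ℤ`-order `O` in a quaternion algebra over `ℚ` and a prime
`p`, the number

  `a_k = #{z Λ ⊆ Λ : [Λ : z Λ] = p^{2k}}`    (`Λ = O_(p)`, `z` a unit of `B` in `Λ`)

through the images in `Λ / p^R Λ` of the unit group `G = Λˣ` (realised as the stabiliser
`Stab_{Bˣ}(Λ)`, `IsZOrder.mem_stabilizer_localAt_iff`) and of the norm-level sets `X_k`:

* `IsZOrder.pow_mul_ncard_image_normLevel_eq` — **`p^{2k} · |X_k mod p^R| = a_k · |G mod p^R|`**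
  for `R ≥ k + 1` (each ideal `z₀ Λ` of level `k` has generator set `z₀ G`, and
  `|G mod p^R| = p^{2k} |z₀ G mod p^R|`, `IsZOrder.ncard_image_units_eq_mul`, because reduction of
  `g ↦ z₀ g` is `[z₀⁻¹ p^R Λ : p^R Λ] = [Λ : z₀ Λ]`-to-one on `G`);
* `IsZOrder.ncard_image_units_eq_pow_mul` — **`|G mod p^R| = p^{4(R-1)} |G mod p|`** (`R ≥ 1`);
* `IsZOrder.pow_eq_sum_ncard_image_normLevel_add` — **`p^{4R} = ∑_{k<R} |X_k mod p^R| + |Y_R mod p^R|`**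
  with `Y_R = Λ ∖ ⋃_{k<R} X_k`;

so that `∑_{k<R} a_k p^{-2k} = (p⁴ / |G mod p|)(1 - |Y_R mod p^R| / p^{4R})`: the generating
function of the `a_k` at `p⁻²` is `p⁴ / |(O/pO)ˣ|` as soon as `|Y_R mod p^R| = o(p^{4R})` — the only
model-dependent inputs left (`|(O/pO)ˣ|` and the density of norms divisible by `p^R`) are supplied
for maximal, Eichler and ramified local orders elsewhere. Ingredients proved here:

* `LocalOrder`: `Λ` has `p`-integral traces and norms, is stable under `x ↦ x̄`, and
  **`1 + p Λ ⊆ Λˣ`** (`IsZOrder.exists_inv_one_add_of_mem_localAt`: `nrd(1 + p y)` is a `p`-adic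
  unit, inverse `nrd⁻¹ · (1 + p y)‾`);
* `Scaling`, `Images`: `[O : c O] = c⁴`, `[Λ : p^R Λ] = p^{4R}`, `[z⁻¹ p^R Λ : p^R Λ] = [Λ : z Λ]`,
  `|H mod K| = [H : K]`, translation invariance, and counting through fibres;
* `UnitsLevel`: `G + p Λ ⊆ G`, `u₀ + z⁻¹ p^R Λ ⊆ G` and **congruent elements generate the same
  ideal** (`IsZOrder.exists_eq_mul_of_sub_mem`: `z' ≡ z mod p^R Λ`, `z ∈ X_k`, `R > k` ⇒ `z' = z u`);
  `v_p(nrd z) = k` on `X_k` (`exists_relIndex_units_smul_localAt_eq_pow` of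
  `QuaternionSubidealCount.lean`).

## References

* J. Voight, *Quaternion Algebras*, GTM 288 (2021), §26.4, Prop. 26.6.4, Lemma 26.6.7
  [Voight2021].
* O. Körner, *Traces of Eichler–Brandt matrices and type numbers of quaternion orders over totally
  real fields*, Proc. Indian Acad. Sci. 97 (1987), §3 (unit indices via `O/pO`).
* M.-F. Vignéras, *Arithmétique des algèbres de quaternions*, LNM 800 (1980), Ch. II §4, Ch. V §2
  [VignerasLNM800].
-/

noncomputable section

open scoped Pointwise

universe u

namespace Literature.NumberTheory.Automorphic

variable {B : Type u} [Ring B] [Algebra ℚ B] [IsQuaternionAlgebra ℚ B]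

/-! ### The local order `Λ = O_(p)`: integrality, involution, units -/

section LocalOrder

variable {O : Submodule ℤ B} (hO : IsZOrder O) {p : ℕ} [hp : Fact p.Prime]
include hO

/-- Elements of `O_(p)` have `p`-integral reduced trace. [cite: VignerasLNM800, Ch. I §4 Lemme 4.1] -/
theorem IsZOrder.not_dvd_den_reducedTrace_of_mem_localAt {x : B} (hx : x ∈ localAt p O) :
    ¬ p ∣ (reducedTrace ℚ B x).den := by
  obtain ⟨m, hm0, hm, hmx⟩ := hx
  obtain ⟨t, -, ht, -⟩ := hO.toIsOrder.exists_int_reducedTrace_reducedNorm hmx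
  rw [natCast_zsmul_eq_ratCast_smul, map_smul, smul_eq_mul] at ht
  have hmQ : (m : ℚ) ≠ 0 := by exact_mod_cast hm0
  have : reducedTrace ℚ B x = (t : ℚ) * ((m : ℚ))⁻¹ := by
    rw [← ht]; field_simp
  rw [this]
  refine not_dvd_den_mul hp.out (not_dvd_den_intCast hp.out t) ?_
  rw [Rat.inv_natCast_den, if_neg hm0]
  exact fun h => hp.out.one_lt.ne' (Nat.Coprime.eq_one_of_dvd hm.symm h)

/-- Elements of `O_(p)` have `p`-integral reduced norm. [cite: VignerasLNM800, Ch. I §4 Lemme 4.1] -/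
theorem IsZOrder.not_dvd_den_reducedNorm_of_mem_localAt {x : B} (hx : x ∈ localAt p O) :
    ¬ p ∣ (reducedNorm ℚ B x).den := by
  obtain ⟨m, hm0, hm, hmx⟩ := hx
  obtain ⟨n, hn⟩ := hO.exists_int_reducedNorm hmx
  rw [natCast_zsmul_eq_ratCast_smul, reducedNorm_smul] at hn
  have hmQ : (m : ℚ) ≠ 0 := by exact_mod_cast hm0
  have : reducedNorm ℚ B x = (n : ℚ) * (((m : ℚ))⁻¹ * ((m : ℚ))⁻¹) := by
    rw [← hn]; field_simp
  rw [this]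
  have hm' : ¬ p ∣ ((m : ℚ))⁻¹.den := by
    rw [Rat.inv_natCast_den, if_neg hm0]
    exact fun h => hp.out.one_lt.ne' (Nat.Coprime.eq_one_of_dvd hm.symm h)
  exact not_dvd_den_mul hp.out (not_dvd_den_intCast hp.out n) (not_dvd_den_mul hp.out hm' hm')

omit hp in
/-- `O_(p)` is stable under the standard involution. [cite: VignerasLNM800, Ch. I §4 Lemme 4.12] -/
theorem IsZOrder.standardInvolution_mem_localAt {x : B} (hx : x ∈ localAt p O) :
    standardInvolution ℚ B x ∈ localAt p O := by
  obtain ⟨m, hm0, hm, hmx⟩ := hx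
  refine ⟨m, hm0, hm, ?_⟩
  rw [natCast_zsmul_eq_ratCast_smul, ← standardInvolution_smul, ← natCast_zsmul_eq_ratCast_smul]
  exact hO.toIsOrder.standardInvolution_mem hmx

omit [Algebra ℚ B] [IsQuaternionAlgebra ℚ B] hp in
/-- `O_(p)` is multiplicatively closed. [folklore] -/
theorem IsZOrder.mul_mem_localAt {a b : B} (ha : a ∈ localAt p O) (hb : b ∈ localAt p O) :
    a * b ∈ localAt p O :=
  Literature.NumberTheory.Automorphic.mul_mem_localAt hO.mul_mem p ha hb

omit [Algebra ℚ B] [IsQuaternionAlgebra ℚ B] hp in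
/-- `1 ∈ O_(p)`. [folklore] -/
theorem IsZOrder.one_mem_localAt : (1 : B) ∈ localAt p O := le_localAt p O hO.one_mem

omit [IsQuaternionAlgebra ℚ B] hO hp in
/-- A rational with denominator prime to `p` has non-negative `p`-adic valuation. [folklore] -/
theorem padicValRat_nonneg_of_not_dvd_den {q : ℚ} (hq : ¬ p ∣ q.den) : 0 ≤ padicValRat p q := by
  rw [padicValRat_def, padicValNat.eq_zero_of_not_dvd hq, Nat.cast_zero, sub_zero]
  exact_mod_cast Nat.zero_le _

omit [IsQuaternionAlgebra ℚ B] hO in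
/-- Naturals have denominator `1`. [folklore] -/
theorem not_dvd_den_natCast (n : ℕ) : ¬ p ∣ (n : ℚ).den := by
  rw [Rat.den_natCast]
  exact hp.out.one_lt.ne' ∘ Nat.dvd_one.mp

/-- **`1 + p O_(p)` consists of units of `O_(p)`**: for `y ∈ O_(p)`, `x = 1 + p y` is a unit of `B`
whose inverse `nrd(x)⁻¹ x̄` lies in `O_(p)` (`nrd x = 1 + p (trd y + p nrd y)` has `p`-adic
valuation `0`). [folklore] -/
theorem IsZOrder.exists_inv_one_add_of_mem_localAt {y : B} (hy : y ∈ localAt p O) :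
    ∃ w ∈ localAt p O, (1 + (p : ℚ) • y) * w = 1 ∧ w * (1 + (p : ℚ) • y) = 1 := by
  set x : B := 1 + (p : ℚ) • y with hxdef
  -- `nrd x = 1 + p s` with `s` `p`-integral
  set s : ℚ := reducedTrace ℚ B y + (p : ℚ) * reducedNorm ℚ B y with hsdef
  have hs : ¬ p ∣ s.den :=
    not_dvd_den_add hp.out (hO.not_dvd_den_reducedTrace_of_mem_localAt hy)
      (not_dvd_den_mul hp.out (not_dvd_den_natCast p) (hO.not_dvd_den_reducedNorm_of_mem_localAt hy))
  have hnrd : reducedNorm ℚ B x = 1 + (p : ℚ) * s := by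
    rw [hxdef, add_comm, reducedNorm_add ℚ, reducedNorm_smul, reducedNorm_one ℚ B,
      standardInvolution_one, mul_one, map_smul, smul_eq_mul, hsdef]
    ring
  have hvs : 0 ≤ padicValRat p s := padicValRat_nonneg_of_not_dvd_den hs
  -- `v_p(nrd x) = 0`
  have hv : padicValRat p (reducedNorm ℚ B x) = 0 ∧ reducedNorm ℚ B x ≠ 0 := by
    rw [hnrd]
    by_cases hs0 : s = 0
    · simp [hs0]
    have hp0 : (p : ℚ) ≠ 0 := by exact_mod_cast hp.out.ne_zero
    have hvps : 1 ≤ padicValRat p ((p : ℚ) * s) := by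
      rw [padicValRat.mul hp0 hs0, padicValRat.self hp.out.one_lt]; linarith
    have hne : (1 + (p : ℚ) * s) ≠ 0 := by
      intro h0
      have h' : (p : ℚ) * s = -1 := by linear_combination h0
      rw [h', padicValRat.neg, padicValRat.one] at hvps
      linarith
    refine ⟨le_antisymm ?_ ?_, hne⟩
    · by_contra hlt
      push Not at hlt
      have h := padicValRat.min_le_padicValRat_add (p := p) (q := 1 + (p : ℚ) * s) (r := -((p : ℚ) * s))
        (by rw [add_neg_cancel_right]; exact one_ne_zero)
      rw [add_neg_cancel_right, padicValRat.one, padicValRat.neg] at h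
      have : (0 : ℤ) < min (padicValRat p (1 + (p : ℚ) * s)) (padicValRat p ((p : ℚ) * s)) :=
        lt_min hlt (by linarith)
      linarith
    · have h := padicValRat.min_le_padicValRat_add (p := p) (q := (1 : ℚ)) (r := (p : ℚ) * s) hne
      rw [padicValRat.one] at h
      exact le_trans (le_min le_rfl (by linarith)) h
  obtain ⟨hv0, hx0⟩ := hv
  refine ⟨(reducedNorm ℚ B x)⁻¹ • standardInvolution ℚ B x, ?_, mul_inv_smul_standardInvolution ℚ hx0,
    inv_smul_standardInvolution_mul ℚ hx0⟩
  refine rat_smul_mem_localAt ?_ (not_dvd_den_of_padicValRat_nonneg (by rw [padicValRat.inv, hv0, neg_zero]))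
  rw [hxdef, standardInvolution_add, standardInvolution_one, standardInvolution_smul]
  exact add_mem hO.one_mem_localAt
    (rat_smul_mem_localAt (hO.standardInvolution_mem_localAt hy) (not_dvd_den_natCast p))

end LocalOrder

/-! ### Scaled lattices `p^R Λ` and their indices -/

section Scaling

variable {p : ℕ} [hp : Fact p.Prime]

omit [IsQuaternionAlgebra ℚ B] hp in
/-- Localisation commutes with scaling by a non-zero integer: `c L_(p) = (c L)_(p)`. [folklore] -/
theorem intCast_smul_localAt (c : ℤ) (L : Submodule ℤ B) :
    c • localAt p L = localAt p (c • L) := by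
  ext x
  rw [Submodule.mem_smul_pointwise_iff_exists, mem_localAt_iff]
  constructor
  · rintro ⟨y, ⟨m, hm0, hm, hmy⟩, rfl⟩
    refine ⟨m, hm0, hm, ?_⟩
    rw [smul_comm]
    exact Submodule.smul_mem_pointwise_smul _ c L hmy
  · rintro ⟨m, hm0, hm, hmx⟩
    obtain ⟨w, hw, hwx⟩ := (Submodule.mem_smul_pointwise_iff_exists _ c L).mp hmx
    refine ⟨(m : ℚ)⁻¹ • w, inv_smul_mem_localAt hm0 hm (le_localAt p L hw), ?_⟩
    have hx : x = (m : ℚ)⁻¹ • ((m : ℤ) • x) := (inv_smul_natCast_zsmul hm0 x).symm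
    rw [hx, ← hwx, smul_comm]

omit [IsQuaternionAlgebra ℚ B] hp in
/-- Scaling by an integer is scaling by the corresponding central unit. [folklore] -/
theorem intCast_smul_eq_units_smul {c : ℤ} (u : Bˣ) (hu : (u : B) = algebraMap ℚ B c)
    (L : Submodule ℤ B) : c • L = u • L := by
  have key : ∀ y : B, c • y = u • y := fun y => by
    rw [Units.smul_def, hu, smul_eq_mul, ← Algebra.smul_def, Int.cast_smul_eq_zsmul]
  apply le_antisymm
  · intro x hx
    obtain ⟨y, hy, rfl⟩ := (Submodule.mem_smul_pointwise_iff_exists x c L).mp hx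
    rw [key]
    exact Submodule.smul_mem_pointwise_smul y u L hy
  · intro x hx
    rw [mem_units_smul_submodule_iff] at hx
    have : x = c • ((u⁻¹ : Bˣ) • x) := by rw [key, smul_inv_smul]
    rw [this]
    exact Submodule.smul_mem_pointwise_smul _ c L hx

omit [Algebra ℚ B] [IsQuaternionAlgebra ℚ B] hp in
/-- Left translation by a unit commutes with scaling by an integer. [folklore] -/
theorem units_smul_intCast_smul (z : Bˣ) (c : ℤ) (L : Submodule ℤ B) : z • (c • L) = c • (z • L) := by
  apply le_antisymm
  · intro x hx
    rw [mem_units_smul_submodule_iff] at hx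
    obtain ⟨y, hy, hyx⟩ := (Submodule.mem_smul_pointwise_iff_exists _ c L).mp hx
    have : x = c • (z • y) := by
      rw [smul_comm, hyx, smul_inv_smul]
    rw [this]
    exact Submodule.smul_mem_pointwise_smul _ c _ (Submodule.smul_mem_pointwise_smul y z L hy)
  · intro x hx
    obtain ⟨w, hw, rfl⟩ := (Submodule.mem_smul_pointwise_iff_exists x c _).mp hx
    rw [mem_units_smul_submodule_iff] at hw ⊢
    rw [smul_comm]
    exact Submodule.smul_mem_pointwise_smul _ c L hw

omit [IsQuaternionAlgebra ℚ B] hp in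
/-- The central unit `c · 1` of `B` for a non-zero integer `c`. [folklore] -/
theorem isUnit_algebraMap_intCast {c : ℤ} (hc : c ≠ 0) : IsUnit (algebraMap ℚ B (c : ℚ)) :=
  (IsUnit.mk0 (c : ℚ) (by exact_mod_cast hc)).map (algebraMap ℚ B)

/-- **`[O : c O] = c⁴`** for a `ℤ`-order `O` in a quaternion algebra over `ℚ` and an integer
`c ≠ 0` (`[O : α O] = nrd(α)²` with `nrd(c) = c²`). [folklore] -/
theorem relIndex_intCast_smul_eq {O : Submodule ℤ B} (hO : IsZOrder O) {c : ℤ} (hc : c ≠ 0) :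
    (c • O).toAddSubgroup.relIndex O.toAddSubgroup = c.natAbs ^ 4 := by
  set u : Bˣ := (isUnit_algebraMap_intCast (B := B) hc).unit with hudef
  have hu : (u : B) = algebraMap ℚ B c := rfl
  have huO : (u : B) ∈ Brandt.leftOrder O := by
    rw [hO.toIsOrder.leftOrder_eq, hu, Algebra.algebraMap_eq_smul_one, Int.cast_smul_eq_zsmul]
    exact O.smul_mem c hO.one_mem
  have h := Brandt.cast_relIndex_units_smul_eq_reducedNorm_sq hO.isFullLattice huO
  rw [← intCast_smul_eq_units_smul u hu] at h
  rw [hu, reducedNorm_algebraMap] at h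
  have h' : (((c • O).toAddSubgroup.relIndex O.toAddSubgroup : ℕ) : ℚ) = ((c.natAbs ^ 4 : ℕ) : ℚ) := by
    rw [h]; push_cast; rw [Nat.cast_natAbs, Int.cast_abs]; nlinarith [sq_abs (c : ℚ), sq_nonneg (c : ℚ)]
  exact_mod_cast h'

/-- **`[O_(p) : p^R O_(p)] = p ^ (4 R)`**. [folklore] -/
theorem relIndex_pow_smul_localAt {O : Submodule ℤ B} (hO : IsZOrder O) (R : ℕ) :
    (((p : ℤ) ^ R) • localAt p O).toAddSubgroup.relIndex (localAt p O).toAddSubgroup = p ^ (4 * R) := by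
  have hc : ((p : ℤ) ^ R) ≠ 0 := pow_ne_zero R (by exact_mod_cast hp.out.ne_zero)
  have hle : ((p : ℤ) ^ R) • O ≤ O := by
    rintro x hx
    obtain ⟨y, hy, rfl⟩ := (Submodule.mem_smul_pointwise_iff_exists x _ O).mp hx
    exact O.smul_mem _ hy
  have hidx := relIndex_intCast_smul_eq hO hc
  have hne : (((p : ℤ) ^ R) • O).toAddSubgroup.relIndex O.toAddSubgroup ≠ 0 := by
    rw [hidx]; exact pow_ne_zero 4 (Int.natAbs_ne_zero.mpr hc)
  rw [intCast_smul_localAt, relIndex_localAt O _ hle hne, hidx]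
  congr 1
  rw [Int.natAbs_pow, Int.natAbs_natCast, ← pow_mul, hp.out.factorization_pow, Finsupp.single_eq_same,
    mul_comm]

omit [IsQuaternionAlgebra ℚ B] hp in
/-- Scaling both lattices by an integer `c ≠ 0` does not change the index. [folklore] -/
theorem relIndex_intCast_smul_intCast_smul {c : ℤ} (hc : c ≠ 0) (M N : Submodule ℤ B) :
    (c • M).toAddSubgroup.relIndex (c • N).toAddSubgroup = M.toAddSubgroup.relIndex N.toAddSubgroup := by
  haveI : IsAddTorsionFree B := isAddTorsionFree_of_charZero_module ℚ B
  rw [Submodule.pointwise_smul_toAddSubgroup, Submodule.pointwise_smul_toAddSubgroup,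
    AddSubgroup.pointwise_smul_def, AddSubgroup.pointwise_smul_def]
  exact AddSubgroup.relIndex_map_map_of_injective _ _ (smul_right_injective B hc)

omit [IsQuaternionAlgebra ℚ B] in
/-- **`[z⁻¹ p^R Λ : p^R Λ] = [Λ : z Λ]`** for a unit `z` and `Λ = O_(p)`: translating by `z` and
unscaling by `p^R`. [folklore] -/
theorem relIndex_pow_smul_inv_smul (O : Submodule ℤ B) (z : Bˣ) (R : ℕ) :
    (((p : ℤ) ^ R) • localAt p O).toAddSubgroup.relIndex
        (z⁻¹ • (((p : ℤ) ^ R) • localAt p O)).toAddSubgroup =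
      (z • localAt p O).toAddSubgroup.relIndex (localAt p O).toAddSubgroup := by
  have hc : ((p : ℤ) ^ R) ≠ 0 := pow_ne_zero R (by exact_mod_cast hp.out.ne_zero)
  conv_lhs => rw [← relIndex_units_smul z, smul_inv_smul, units_smul_intCast_smul]
  exact relIndex_intCast_smul_intCast_smul hc _ _

end Scaling

/-! ### Images in `B / p^R Λ` and their cardinalities -/

section Images

omit [Algebra ℚ B] [IsQuaternionAlgebra ℚ B] in
/-- For additive subgroups `K ≤ H` of `B`, the image of `H` in `B / K` has `[H : K]` elements.
[folklore] -/
theorem ncard_image_mk_eq_relIndex (K H : AddSubgroup B) :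
    (QuotientAddGroup.mk '' (H : Set B) : Set (B ⧸ K)).ncard = K.relIndex H := by
  classical
  rw [AddSubgroup.relIndex, AddSubgroup.index, ← Nat.card_coe_set_eq]
  refine Nat.card_congr ?_
  symm
  refine Equiv.ofBijective (Quotient.lift (fun h : H => ⟨QuotientAddGroup.mk (h : B), h, h.2, rfl⟩)
    fun a b hab => Subtype.ext ?_) ⟨?_, ?_⟩
  · exact QuotientAddGroup.eq.mpr (by simpa [AddSubgroup.mem_addSubgroupOf] using QuotientAddGroup.leftRel_apply.mp hab)
  · rintro ⟨a⟩ ⟨b⟩ hab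
    have h := congrArg Subtype.val hab
    exact Quotient.sound (QuotientAddGroup.leftRel_apply.mpr (by
      rw [AddSubgroup.mem_addSubgroupOf]; exact QuotientAddGroup.eq.mp h))
  · rintro ⟨q, h, hh, rfl⟩
    exact ⟨Quotient.mk _ ⟨h, hh⟩, rfl⟩

omit [Algebra ℚ B] [IsQuaternionAlgebra ℚ B] in
/-- Translation does not change the size of an image in `B / K`. [folklore] -/
theorem ncard_image_mk_add_left (K : AddSubgroup B) (a : B) (S : Set B) :
    (QuotientAddGroup.mk '' ((a + ·) '' S) : Set (B ⧸ K)).ncard =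
      (QuotientAddGroup.mk '' S : Set (B ⧸ K)).ncard := by
  rw [Set.image_image]
  have : (fun x => (QuotientAddGroup.mk (a + x) : B ⧸ K)) =
      (fun q => (QuotientAddGroup.mk a : B ⧸ K) + q) ∘ (QuotientAddGroup.mk : B → B ⧸ K) := by
    ext x; simp
  rw [this, Set.image_comp]
  exact Set.ncard_image_of_injective _ (add_right_injective _)

omit [Algebra ℚ B] [IsQuaternionAlgebra ℚ B] in
/-- **Counting through fibres**: if every non-empty fibre of `f` on a finite set `s` has exactly
`c` elements then `|s| = c · |f(s)|`. [folklore] -/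
theorem Set.ncard_eq_mul_ncard_image_of_fiber {α β : Type*} {s : Set α} (hs : s.Finite) (f : α → β)
    (c : ℕ) (hfib : ∀ b ∈ f '' s, (s ∩ f ⁻¹' {b}).ncard = c) : s.ncard = c * (f '' s).ncard := by
  classical
  have hcard := Finset.card_eq_sum_card_fiberwise (s := hs.toFinset) (t := hs.toFinset.image f)
    (f := f) fun x hx => Finset.mem_image_of_mem f hx
  rw [Set.ncard_eq_toFinset_card s hs, hcard]
  have himg : (f '' s).ncard = (hs.toFinset.image f).card := by
    rw [Set.ncard_eq_toFinset_card _ (hs.image f), Set.Finite.toFinset_image]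
  rw [himg, mul_comm, ← smul_eq_mul, ← Finset.sum_const]
  refine Finset.sum_congr rfl fun b hb => ?_
  rw [← hfib b (by simpa using hb), Set.ncard_eq_toFinset_card _ (hs.inter_of_left _)]
  congr 1
  ext x
  simp [and_comm]

end Images

/-! ### Units of `O_(p)` and the norm-level sets `X_k` -/

section UnitsLevel

variable (p : ℕ) (O : Submodule ℤ B)

/-- The **norm-level set** `X_k = {z ∈ O_(p)ˣ-candidates : [O_(p) : z O_(p)] = p^{2k}}`: units `z`
of `B` lying in `O_(p)` and generating a principal right ideal of index `p ^ (2 k)` — for an order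
in a division algebra, the elements of `O_(p)` with `v_p(nrd z) = k`
(`exists_relIndex_units_smul_localAt_eq_pow`). [folklore] -/
def normLevelUnits (k : ℕ) : Set Bˣ :=
  {z | (z : B) ∈ localAt p O ∧
    (z • localAt p O).toAddSubgroup.relIndex (localAt p O).toAddSubgroup = p ^ (2 * k)}

variable {p O}

omit [Algebra ℚ B] [IsQuaternionAlgebra ℚ B] in
/-- Membership in `X_k` (definitional). [folklore] -/
@[simp] theorem mem_normLevelUnits_iff {k : ℕ} {z : Bˣ} :
    z ∈ normLevelUnits p O k ↔ (z : B) ∈ localAt p O ∧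
      (z • localAt p O).toAddSubgroup.relIndex (localAt p O).toAddSubgroup = p ^ (2 * k) := Iff.rfl

variable {p : ℕ} [hp : Fact p.Prime] {O : Submodule ℤ B} (hO : IsZOrder O)
include hO

omit [Algebra ℚ B] [IsQuaternionAlgebra ℚ B] hp in
/-- **The unit group of `O_(p)` is the stabiliser of `O_(p)`**: `u ∈ Stab_{Bˣ}(O_(p))` iff
`u, u⁻¹ ∈ O_(p)`. [folklore] -/
theorem IsZOrder.mem_stabilizer_localAt_iff {u : Bˣ} :
    u ∈ MulAction.stabilizer Bˣ (localAt p O) ↔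
      (u : B) ∈ localAt p O ∧ ((u⁻¹ : Bˣ) : B) ∈ localAt p O := by
  rw [mem_stabilizer_submodule_iff, hO.leftOrderOf_localAt_eq]

omit [Algebra ℚ B] [IsQuaternionAlgebra ℚ B] hp in
/-- An element of `O_(p)` with a two-sided inverse in `O_(p)` is a unit of `O_(p)`. [folklore] -/
theorem IsZOrder.exists_stabilizer_of_exists_inv {x : B} (hx : x ∈ localAt p O)
    (hinv : ∃ w ∈ localAt p O, x * w = 1 ∧ w * x = 1) :
    ∃ u ∈ MulAction.stabilizer Bˣ (localAt p O), (u : B) = x := by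
  obtain ⟨w, hw, hxw, hwx⟩ := hinv
  exact ⟨⟨x, w, hxw, hwx⟩, hO.mem_stabilizer_localAt_iff.mpr ⟨hx, hw⟩, rfl⟩

/-- **`G + p O_(p) ⊆ G`**: for a unit `u` of `O_(p)` and `y ∈ O_(p)`, `u + p y = u (1 + p u⁻¹ y)` is
again a unit of `O_(p)`. [folklore] -/
theorem IsZOrder.exists_stabilizer_eq_add_smul {u : Bˣ} (hu : u ∈ MulAction.stabilizer Bˣ (localAt p O))
    {y : B} (hy : y ∈ localAt p O) :
    ∃ u' ∈ MulAction.stabilizer Bˣ (localAt p O), (u' : B) = u + (p : ℚ) • y := by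
  rw [hO.mem_stabilizer_localAt_iff] at hu
  have hy' : ((u⁻¹ : Bˣ) : B) * y ∈ localAt p O := hO.mul_mem_localAt hu.2 hy
  obtain ⟨v, hv, hvval⟩ := hO.exists_stabilizer_of_exists_inv
    (add_mem hO.one_mem_localAt (rat_smul_mem_localAt hy' (not_dvd_den_natCast p)))
    (hO.exists_inv_one_add_of_mem_localAt hy')
  refine ⟨u * v, Subgroup.mul_mem _ (hO.mem_stabilizer_localAt_iff.mpr hu) hv, ?_⟩
  rw [Units.val_mul, hvval, mul_add, mul_one, mul_smul_comm, Units.mul_inv_cancel_left]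

/-- The norm-level of a unit of `B` lying in `O_(p)` is `v_p(nrd)`: if `z ∈ X_k` then
`v_p(nrd z) = k`. [folklore] -/
theorem IsZOrder.padicValRat_reducedNorm_of_mem_normLevelUnits {k : ℕ} {z : Bˣ}
    (hz : z ∈ normLevelUnits p O k) : padicValRat p (reducedNorm ℚ B z) = k := by
  obtain ⟨k', hk', hidx⟩ := exists_relIndex_units_smul_localAt_eq_pow hO z hz.1
  rw [hz.2] at hidx
  have : 2 * k = 2 * k' := Nat.pow_right_injective hp.out.two_le hidx
  rw [hk']
  congr 1
  omega

/-- Every unit of `B` lying in `O_(p)` lies in exactly one `X_k`. [folklore] -/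
theorem IsZOrder.exists_mem_normLevelUnits {z : Bˣ} (hz : (z : B) ∈ localAt p O) :
    ∃ k : ℕ, z ∈ normLevelUnits p O k := by
  obtain ⟨k, -, hidx⟩ := exists_relIndex_units_smul_localAt_eq_pow hO z hz
  exact ⟨k, hz, hidx⟩

omit [Algebra ℚ B] [IsQuaternionAlgebra ℚ B] hO in
/-- The sets `X_k` are pairwise disjoint. [folklore] -/
theorem normLevelUnits_disjoint {k k' : ℕ} {z : Bˣ} (hz : z ∈ normLevelUnits p O k)
    (hz' : z ∈ normLevelUnits p O k') : k = k' := by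
  have h := hz.2.symm.trans hz'.2
  have := Nat.pow_right_injective hp.out.two_le h
  omega

/-- **`z⁻¹ p^R Λ ⊆ p Λ` for `z ∈ X_k`, `R ≥ k + 1`**: `z⁻¹ y = p · ((p^{R-1}/nrd z)(z̄ y₀))` for
`y = p^R y₀`. [folklore] -/
theorem IsZOrder.exists_inv_mul_eq_smul {k R : ℕ} (hR : k + 1 ≤ R) {z : Bˣ}
    (hz : z ∈ normLevelUnits p O k) {y : B} (hy : y ∈ ((p : ℤ) ^ R) • localAt p O) :
    ∃ y' ∈ localAt p O, ((z⁻¹ : Bˣ) : B) * y = (p : ℚ) • y' := by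
  obtain ⟨y₀, hy₀, rfl⟩ := (Submodule.mem_smul_pointwise_iff_exists y _ _).mp hy
  set ν := reducedNorm ℚ B z with hνdef
  have hν0 : ν ≠ 0 := (isUnit_iff_reducedNorm_ne_zero_holds ℚ B (z : B)).mp z.isUnit
  have hv : padicValRat p ν = k := hO.padicValRat_reducedNorm_of_mem_normLevelUnits hz
  have hinv : ((z⁻¹ : Bˣ) : B) = ν⁻¹ • standardInvolution ℚ B z :=
    Units.inv_eq_of_mul_eq_one_right (mul_inv_smul_standardInvolution ℚ hν0)
  -- the scalar `q = p^{R-1} / ν` is `p`-integral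
  set q : ℚ := (p : ℚ) ^ (R - 1) * ν⁻¹ with hqdef
  have hq : ¬ p ∣ q.den := by
    refine not_dvd_den_of_padicValRat_nonneg ?_
    rw [hqdef, padicValRat.mul (pow_ne_zero _ (by exact_mod_cast hp.out.ne_zero)) (inv_ne_zero hν0),
      padicValRat.pow, padicValRat.self hp.out.one_lt, padicValRat.inv, hv]
    have : (k : ℤ) + 1 ≤ R := by exact_mod_cast hR
    rw [Nat.cast_sub (by omega)]
    push_cast
    linarith
  refine ⟨q • (standardInvolution ℚ B z * y₀), rat_smul_mem_localAt
    (hO.mul_mem_localAt (hO.standardInvolution_mem_localAt hz.1) hy₀) hq, ?_⟩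
  rw [hinv, smul_mul_assoc, mul_smul_comm, smul_smul, ← Int.cast_smul_eq_zsmul ℚ, smul_smul, hqdef]
  congr 1
  push_cast
  have hR1 : R = (R - 1) + 1 := by omega
  conv_lhs => rw [hR1, pow_succ]
  ring

/-- **`u₀ + z⁻¹ p^R Λ ⊆ G`** for a unit `u₀` of `O_(p)`, `z ∈ X_k` and `R ≥ k + 1`. [folklore] -/
theorem IsZOrder.exists_stabilizer_eq_add_inv_mul {k R : ℕ} (hR : k + 1 ≤ R) {z : Bˣ}
    (hz : z ∈ normLevelUnits p O k) {u₀ : Bˣ} (hu₀ : u₀ ∈ MulAction.stabilizer Bˣ (localAt p O))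
    {y : B} (hy : y ∈ ((p : ℤ) ^ R) • localAt p O) :
    ∃ u ∈ MulAction.stabilizer Bˣ (localAt p O), (u : B) = u₀ + ((z⁻¹ : Bˣ) : B) * y := by
  obtain ⟨y', hy', hyy'⟩ := hO.exists_inv_mul_eq_smul hR hz hy
  rw [hyy']
  exact hO.exists_stabilizer_eq_add_smul hu₀ hy'

/-- **Congruent elements generate the same ideal**: if `z ∈ X_k`, `z' ∈ O_(p)` and
`z' ≡ z (mod p^R Λ)` with `R ≥ k + 1`, then `z' = z u` for a unit `u` of `O_(p)`. [folklore] -/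
theorem IsZOrder.exists_eq_mul_of_sub_mem {k R : ℕ} (hR : k + 1 ≤ R) {z : Bˣ}
    (hz : z ∈ normLevelUnits p O k) {z' : B} (hzz' : z' - z ∈ ((p : ℤ) ^ R) • localAt p O) :
    ∃ u ∈ MulAction.stabilizer Bˣ (localAt p O), z' = z * u := by
  obtain ⟨u, hu, huval⟩ := hO.exists_stabilizer_eq_add_inv_mul hR hz (u₀ := 1) (Subgroup.one_mem _) hzz'
  refine ⟨u, hu, ?_⟩
  rw [huval, Units.val_one, mul_add, mul_one, Units.mul_inv_cancel_left, add_sub_cancel]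

omit hp hO in
omit [Algebra ℚ B] [IsQuaternionAlgebra ℚ B] in
/-- Right multiplication by a unit of `O_(p)` preserves `X_k`. [folklore] -/
theorem mul_mem_normLevelUnits {k : ℕ} {z u : Bˣ} (hz : z ∈ normLevelUnits p O k)
    (hu : u ∈ MulAction.stabilizer Bˣ (localAt p O)) (hzu : (z : B) * u ∈ localAt p O) :
    z * u ∈ normLevelUnits p O k := by
  refine ⟨by simpa using hzu, ?_⟩
  rw [mul_smul, MulAction.mem_stabilizer_iff.mp hu]
  exact hz.2

omit [Algebra ℚ B] [IsQuaternionAlgebra ℚ B] hp in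
/-- `z G ⊆ X_k` for `z ∈ X_k`. [folklore] -/
theorem IsZOrder.mul_mem_normLevelUnits {k : ℕ} {z u : Bˣ} (hz : z ∈ normLevelUnits p O k)
    (hu : u ∈ MulAction.stabilizer Bˣ (localAt p O)) : z * u ∈ normLevelUnits p O k :=
  Literature.NumberTheory.Automorphic.mul_mem_normLevelUnits hz hu
    (hO.mul_mem_localAt hz.1 (hO.mem_stabilizer_localAt_iff.mp hu).1)

omit hp hO in
omit [Algebra ℚ B] [IsQuaternionAlgebra ℚ B] in
/-- `z u O_(p) = z O_(p)` for a unit `u` of `O_(p)`; conversely two elements of `X_k` generating the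
same ideal differ by a unit of `O_(p)`. [folklore] -/
theorem units_smul_localAt_eq_iff {z z' : Bˣ} :
    z' • localAt p O = z • localAt p O ↔ z⁻¹ * z' ∈ MulAction.stabilizer Bˣ (localAt p O) := by
  rw [MulAction.mem_stabilizer_iff, mul_smul, inv_smul_eq_iff]

end UnitsLevel

/-! ### Counting modulo `p ^ R`: units, norm levels and principal ideals -/

section Counting

variable {p : ℕ} [hp : Fact p.Prime] {O : Submodule ℤ B} (hO : IsZOrder O)
include hO

/-- The image of `O_(p)` in `B / p^R O_(p)` has `p ^ (4 R)` elements. [folklore] -/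
theorem IsZOrder.ncard_image_mk_localAt (R : ℕ) :
    (QuotientAddGroup.mk '' (localAt p O : Set B) :
      Set (B ⧸ (((p : ℤ) ^ R) • localAt p O).toAddSubgroup)).ncard = p ^ (4 * R) := by
  rw [show (localAt p O : Set B) = ((localAt p O).toAddSubgroup : Set B) from rfl,
    ncard_image_mk_eq_relIndex, relIndex_pow_smul_localAt hO R]

/-- The image of `O_(p)` in `B / p^R O_(p)` is finite. [folklore] -/
theorem IsZOrder.finite_image_mk_localAt (R : ℕ) :
    (QuotientAddGroup.mk '' (localAt p O : Set B) :
      Set (B ⧸ (((p : ℤ) ^ R) • localAt p O).toAddSubgroup)).Finite :=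
  Set.finite_of_ncard_ne_zero (by rw [hO.ncard_image_mk_localAt R]; exact pow_ne_zero _ hp.out.ne_zero)

omit [Algebra ℚ B] [IsQuaternionAlgebra ℚ B] hp hO in
/-- `z (p^R Λ) ⊆ p^R Λ` for `z ∈ Λ = O_(p)` (`Λ` multiplicatively closed). [folklore] -/
theorem mul_mem_pow_smul_localAt (hmul : ∀ a ∈ localAt p O, ∀ b ∈ localAt p O, a * b ∈ localAt p O)
    {z : B} (hz : z ∈ localAt p O) {R : ℕ} {x : B} (hx : x ∈ ((p : ℤ) ^ R) • localAt p O) :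
    z * x ∈ ((p : ℤ) ^ R) • localAt p O := by
  obtain ⟨y, hy, rfl⟩ := (Submodule.mem_smul_pointwise_iff_exists x _ _).mp hx
  rw [mul_smul_comm]
  exact Submodule.smul_mem_pointwise_smul _ _ _ (hmul _ hz _ hy)

/-- **Units modulo `p^R` versus a translate `z₀ G`**: for `z₀ ∈ X_k` and `R ≥ k + 1`, the image of
the unit group `G` of `O_(p)` in `B / p^R O_(p)` has exactly `p^{2k}` times as many elements as the
image of `z₀ G` (the map `ḡ ↦ z₀ ḡ` is `p^{2k}`-to-one: its fibres are the classes of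
`u₀ + z₀⁻¹ p^R Λ ⊆ G`, and `[z₀⁻¹ p^R Λ : p^R Λ] = [Λ : z₀ Λ] = p^{2k}`). [folklore] -/
theorem IsZOrder.ncard_image_units_eq_mul {k R : ℕ} (hR : k + 1 ≤ R) {z₀ : Bˣ}
    (hz₀ : z₀ ∈ normLevelUnits p O k) :
    (QuotientAddGroup.mk '' (Units.val '' (MulAction.stabilizer Bˣ (localAt p O) : Set Bˣ)) :
        Set (B ⧸ (((p : ℤ) ^ R) • localAt p O).toAddSubgroup)).ncard =
      p ^ (2 * k) * (QuotientAddGroup.mk '' ((fun x : B => (z₀ : B) * x) ''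
        (Units.val '' (MulAction.stabilizer Bˣ (localAt p O) : Set Bˣ))) :
          Set (B ⧸ (((p : ℤ) ^ R) • localAt p O).toAddSubgroup)).ncard := by
  classical
  set K : Submodule ℤ B := ((p : ℤ) ^ R) • localAt p O with hKdef
  set G : Set B := Units.val '' (MulAction.stabilizer Bˣ (localAt p O) : Set Bˣ) with hGdef
  have hGΛ : G ⊆ localAt p O := by
    rintro _ ⟨u, hu, rfl⟩; exact (hO.mem_stabilizer_localAt_iff.mp hu).1
  -- left multiplication by `z₀` on `B / K`
  let φ : B →+ B := AddMonoidHom.mulLeft (z₀ : B)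
  have hφ : K.toAddSubgroup ≤ K.toAddSubgroup.comap φ := fun x hx =>
    mul_mem_pow_smul_localAt (fun a ha b hb => hO.mul_mem_localAt ha hb) hz₀.1 hx
  let F : B ⧸ K.toAddSubgroup →+ B ⧸ K.toAddSubgroup := QuotientAddGroup.map _ _ φ hφ
  have hF : ∀ x : B, F (QuotientAddGroup.mk x) = QuotientAddGroup.mk ((z₀ : B) * x) := fun x =>
    QuotientAddGroup.map_mk _ _ φ hφ x
  have himg : F '' (QuotientAddGroup.mk '' G) =
      QuotientAddGroup.mk '' ((fun x : B => (z₀ : B) * x) '' G) := by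
    ext q
    constructor
    · rintro ⟨_, ⟨g, hg, rfl⟩, rfl⟩; exact ⟨_, ⟨g, hg, rfl⟩, (hF g).symm⟩
    · rintro ⟨_, ⟨g, hg, rfl⟩, rfl⟩; exact ⟨_, ⟨g, hg, rfl⟩, hF g⟩
  rw [← himg]
  refine Set.ncard_eq_mul_ncard_image_of_fiber ((hO.finite_image_mk_localAt R).subset
    (Set.image_mono hGΛ)) F (p ^ (2 * k)) ?_
  rintro b ⟨q, ⟨g₀, ⟨u₀, hu₀, rfl⟩, rfl⟩, rfl⟩
  -- the fibre over `z₀ u₀` is the image of `u₀ + z₀⁻¹ K`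
  have hfib : QuotientAddGroup.mk '' G ∩ F ⁻¹' {F (QuotientAddGroup.mk (u₀ : B))} =
      QuotientAddGroup.mk '' ((fun w : B => (u₀ : B) + w) '' ((z₀⁻¹ • K : Submodule ℤ B) : Set B)) := by
    ext q
    constructor
    · rintro ⟨⟨g, hg, rfl⟩, hq⟩
      rw [Set.mem_preimage, Set.mem_singleton_iff, hF, hF, QuotientAddGroup.eq] at hq
      refine ⟨g, ⟨g - u₀, ?_, by abel⟩, rfl⟩
      rw [SetLike.mem_coe, mem_units_smul_submodule_iff, inv_inv, Units.smul_def, smul_eq_mul, mul_sub]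
      have : (z₀ : B) * g - z₀ * u₀ = -(-(z₀ * g) + z₀ * u₀) := by abel
      rw [this]
      exact K.neg_mem hq
    · rintro ⟨_, ⟨w, hw, rfl⟩, rfl⟩
      rw [SetLike.mem_coe, mem_units_smul_submodule_iff, inv_inv, Units.smul_def, smul_eq_mul] at hw
      obtain ⟨u, hu, huval⟩ := hO.exists_stabilizer_eq_add_inv_mul hR hz₀ hu₀ hw
      rw [Units.inv_mul_cancel_left] at huval
      refine ⟨⟨u, ⟨u, hu, rfl⟩, by rw [huval]⟩, ?_⟩
      rw [Set.mem_preimage, Set.mem_singleton_iff, hF, hF, QuotientAddGroup.eq, mul_add]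
      have : -((z₀ : B) * u₀ + z₀ * w) + z₀ * u₀ = -((z₀ : B) * w) := by abel
      rw [this]
      exact K.neg_mem hw
  rw [hfib, ncard_image_mk_add_left, show (((z₀⁻¹ • K : Submodule ℤ B)) : Set B) =
      ((z₀⁻¹ • K).toAddSubgroup : Set B) from rfl, ncard_image_mk_eq_relIndex, hKdef,
    relIndex_pow_smul_inv_smul, hz₀.2]

/-- **Principal ideals versus norm levels modulo `p^R`** (the unit-density form of the local
factor of Eichler's zeta function, Voight 26.4 / Lemma 26.6.7): for `R ≥ k + 1`,
`p^{2k} · |X_k mod p^R Λ| = a_k · |G mod p^R Λ|`, where `a_k` is the number of principal right ideals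
`z Λ ⊆ Λ = O_(p)` of index `p^{2k}`, `X_k` the corresponding generators and `G` the unit group of
`Λ` (each ideal `z₀ Λ` has generators `z₀ G`, whose image modulo `p^R` has `|G mod p^R| / p^{2k}`
elements by `ncard_image_units_eq_mul`). [cite: Voight2021, Lemma 26.6.7] -/
theorem IsZOrder.pow_mul_ncard_image_normLevel_eq {k R : ℕ} (hR : k + 1 ≤ R) :
    p ^ (2 * k) * (QuotientAddGroup.mk '' (Units.val '' normLevelUnits p O k) :
        Set (B ⧸ (((p : ℤ) ^ R) • localAt p O).toAddSubgroup)).ncard =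
      Nat.card {N : Submodule ℤ B // (∃ z : Bˣ, (z : B) ∈ localAt p O ∧ N = z • localAt p O) ∧
          N.toAddSubgroup.relIndex (localAt p O).toAddSubgroup = p ^ (2 * k)} *
        (QuotientAddGroup.mk '' (Units.val '' (MulAction.stabilizer Bˣ (localAt p O) : Set Bˣ)) :
          Set (B ⧸ (((p : ℤ) ^ R) • localAt p O).toAddSubgroup)).ncard := by
  classical
  set K : Submodule ℤ B := ((p : ℤ) ^ R) • localAt p O with hKdef
  set G : Set B := Units.val '' (MulAction.stabilizer Bˣ (localAt p O) : Set Bˣ) with hGdef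
  set X : Set B := Units.val '' normLevelUnits p O k with hXdef
  -- the set of principal ideals of level `k`, as a set of submodules
  set T : Set (Submodule ℤ B) := {N | ∃ z ∈ normLevelUnits p O k, N = z • localAt p O} with hTdef
  have hT : Nat.card {N : Submodule ℤ B // (∃ z : Bˣ, (z : B) ∈ localAt p O ∧ N = z • localAt p O) ∧
      N.toAddSubgroup.relIndex (localAt p O).toAddSubgroup = p ^ (2 * k)} = T.ncard := by
    rw [← Nat.card_coe_set_eq]
    congr 2
    ext N
    constructor
    · rintro ⟨⟨z, hz, rfl⟩, hidx⟩; exact ⟨z, ⟨hz, hidx⟩, rfl⟩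
    · rintro ⟨z, hz, rfl⟩; exact ⟨⟨z, hz.1, rfl⟩, hz.2⟩
  rw [hT]
  -- the map `q ↦ (ideal generated by any lift of q in X_k)`
  let f : B ⧸ K.toAddSubgroup → Submodule ℤ B := fun q =>
    if h : ∃ z ∈ normLevelUnits p O k, (QuotientAddGroup.mk (z : B) : B ⧸ K.toAddSubgroup) = q
    then h.choose • localAt p O else ⊥
  have hf : ∀ z ∈ normLevelUnits p O k, f (QuotientAddGroup.mk (z : B)) = z • localAt p O := by
    intro z hz
    have h : ∃ z' ∈ normLevelUnits p O k,
        (QuotientAddGroup.mk (z' : B) : B ⧸ K.toAddSubgroup) = QuotientAddGroup.mk (z : B) := ⟨z, hz, rfl⟩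
    simp only [f, dif_pos h]
    obtain ⟨hz', heq⟩ := h.choose_spec
    rw [QuotientAddGroup.eq] at heq
    have hsub : (z : B) - h.choose ∈ K := by rw [sub_eq_neg_add]; exact heq
    obtain ⟨u, hu, hzu⟩ := hO.exists_eq_mul_of_sub_mem hR hz' hsub
    have hzeq : z = h.choose * u := Units.ext (by simpa using hzu)
    conv_rhs => rw [hzeq, mul_smul, MulAction.mem_stabilizer_iff.mp hu]
  have himg : f '' (QuotientAddGroup.mk '' X) = T := by
    rw [Set.image_image, hXdef, Set.image_image]
    ext N
    simp only [Set.mem_image, hTdef, Set.mem_setOf_eq]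
    constructor
    · rintro ⟨z, hz, rfl⟩; exact ⟨z, hz, hf z hz⟩
    · rintro ⟨z, hz, rfl⟩; exact ⟨z, hz, hf z hz⟩
  -- the common fibre size `c = |z₀ G mod K|`
  by_cases hX : (normLevelUnits p O k).Nonempty
  swap
  · rw [Set.not_nonempty_iff_eq_empty] at hX
    have hT0 : T = ∅ := by
      rw [hTdef, Set.eq_empty_iff_forall_notMem]
      rintro N ⟨z, hz, -⟩; rw [hX] at hz; exact hz
    rw [hXdef, hX, hT0]; simp
  obtain ⟨z₁, hz₁⟩ := hX
  set c := (QuotientAddGroup.mk '' ((fun x : B => (z₁ : B) * x) '' G) : Set (B ⧸ K.toAddSubgroup)).ncard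
    with hcdef
  have hGc : (QuotientAddGroup.mk '' G : Set (B ⧸ K.toAddSubgroup)).ncard = p ^ (2 * k) * c :=
    hO.ncard_image_units_eq_mul hR hz₁
  have hc : ∀ z₀ ∈ normLevelUnits p O k,
      (QuotientAddGroup.mk '' ((fun x : B => (z₀ : B) * x) '' G) : Set (B ⧸ K.toAddSubgroup)).ncard = c := by
    intro z₀ hz₀
    have h := hO.ncard_image_units_eq_mul hR hz₀
    rw [hGc] at h
    exact (Nat.eq_of_mul_eq_mul_left (pow_pos hp.out.pos _) h).symm
  -- count through the fibres of `f`
  have hfin : (QuotientAddGroup.mk '' X : Set (B ⧸ K.toAddSubgroup)).Finite :=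
    (hO.finite_image_mk_localAt R).subset (Set.image_mono (by rintro _ ⟨z, hz, rfl⟩; exact hz.1))
  have hcount := Set.ncard_eq_mul_ncard_image_of_fiber hfin f c ?_
  · rw [himg] at hcount
    rw [hcount, hGc]
    ring
  rintro N hN
  rw [himg] at hN
  obtain ⟨z₀, hz₀, rfl⟩ := hN
  have hfib : QuotientAddGroup.mk '' X ∩ f ⁻¹' {z₀ • localAt p O} =
      QuotientAddGroup.mk '' ((fun x : B => (z₀ : B) * x) '' G) := by
    ext q
    constructor
    · rintro ⟨⟨_, ⟨z, hz, rfl⟩, rfl⟩, hq⟩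
      rw [Set.mem_preimage, Set.mem_singleton_iff, hf z hz, units_smul_localAt_eq_iff] at hq
      exact ⟨z, ⟨_, ⟨z₀⁻¹ * z, hq, rfl⟩, by simp⟩, rfl⟩
    · rintro ⟨_, ⟨_, ⟨u, hu, rfl⟩, rfl⟩, rfl⟩
      have hzu : z₀ * u ∈ normLevelUnits p O k := hO.mul_mem_normLevelUnits hz₀ hu
      refine ⟨⟨(z₀ * u : Bˣ), ⟨z₀ * u, hzu, rfl⟩, rfl⟩, ?_⟩
      change f (QuotientAddGroup.mk ((z₀ * u : Bˣ) : B)) = z₀ • localAt p O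
      rw [hf _ hzu, units_smul_localAt_eq_iff]
      simpa using hu
  rw [hfib, hc z₀ hz₀]

end Counting

/-! ### Reduction from `p ^ R` to `p`, and the partition of `Λ / p^R Λ` by norm levels -/

section Reduction

variable {p : ℕ} [hp : Fact p.Prime] {O : Submodule ℤ B} (hO : IsZOrder O)
include hO

omit [Algebra ℚ B] [IsQuaternionAlgebra ℚ B] hp hO in
/-- `p^R Λ ⊆ p Λ` for `R ≥ 1`. [folklore] -/
theorem pow_smul_localAt_le_smul {R : ℕ} (hR : 1 ≤ R) :
    ((p : ℤ) ^ R) • localAt p O ≤ (((p : ℤ) ^ 1) • localAt p O : Submodule ℤ B) := by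
  rintro x hx
  obtain ⟨y, hy, rfl⟩ := (Submodule.mem_smul_pointwise_iff_exists x _ _).mp hx
  have : ((p : ℤ) ^ R) • y = ((p : ℤ) ^ 1) • (((p : ℤ) ^ (R - 1)) • y) := by
    rw [smul_smul, ← pow_add, Nat.add_sub_cancel' hR]
  rw [this]
  exact Submodule.smul_mem_pointwise_smul _ _ _ ((localAt p O).smul_mem _ hy)

/-- `[p Λ : p^R Λ] = p ^ (4 (R - 1))` for `R ≥ 1`. [folklore] -/
theorem IsZOrder.relIndex_pow_smul_smul {R : ℕ} (hR : 1 ≤ R) :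
    (((p : ℤ) ^ R) • localAt p O).toAddSubgroup.relIndex
        ((((p : ℤ) ^ 1) • localAt p O : Submodule ℤ B)).toAddSubgroup = p ^ (4 * (R - 1)) := by
  have hp0 : ((p : ℤ) ^ 1) ≠ 0 := by rw [pow_one]; exact_mod_cast hp.out.ne_zero
  have : ((p : ℤ) ^ R) • localAt p O = ((p : ℤ) ^ 1) • (((p : ℤ) ^ (R - 1)) • localAt p O) := by
    rw [smul_smul, ← pow_add, Nat.add_sub_cancel' hR]
  rw [this, relIndex_intCast_smul_intCast_smul hp0, relIndex_pow_smul_localAt hO]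

/-- **Units modulo `p^R` versus units modulo `p`**: `|G mod p^R Λ| = p^{4(R-1)} · |G mod p Λ|` for
the unit group `G` of `Λ = O_(p)` and `R ≥ 1` (the reduction map is `[p Λ : p^R Λ]`-to-one on `G`,
since `u₀ + p Λ ⊆ G`). [folklore] -/
theorem IsZOrder.ncard_image_units_eq_pow_mul {R : ℕ} (hR : 1 ≤ R) :
    (QuotientAddGroup.mk '' (Units.val '' (MulAction.stabilizer Bˣ (localAt p O) : Set Bˣ)) :
        Set (B ⧸ (((p : ℤ) ^ R) • localAt p O).toAddSubgroup)).ncard =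
      p ^ (4 * (R - 1)) * (QuotientAddGroup.mk ''
        (Units.val '' (MulAction.stabilizer Bˣ (localAt p O) : Set Bˣ)) :
          Set (B ⧸ (((p : ℤ) ^ 1) • localAt p O).toAddSubgroup)).ncard := by
  classical
  set K : Submodule ℤ B := ((p : ℤ) ^ R) • localAt p O with hKdef
  set K₁ : Submodule ℤ B := ((p : ℤ) ^ 1) • localAt p O with hK₁def
  set G : Set B := Units.val '' (MulAction.stabilizer Bˣ (localAt p O) : Set Bˣ) with hGdef
  have hGΛ : G ⊆ localAt p O := by
    rintro _ ⟨u, hu, rfl⟩; exact (hO.mem_stabilizer_localAt_iff.mp hu).1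
  have hle : K.toAddSubgroup ≤ K₁.toAddSubgroup.comap (AddMonoidHom.id B) := fun x hx =>
    pow_smul_localAt_le_smul hR hx
  let F : B ⧸ K.toAddSubgroup →+ B ⧸ K₁.toAddSubgroup := QuotientAddGroup.map _ _ (AddMonoidHom.id B) hle
  have hF : ∀ x : B, F (QuotientAddGroup.mk x) = QuotientAddGroup.mk x := fun x =>
    QuotientAddGroup.map_mk _ _ _ hle x
  have himg : F '' (QuotientAddGroup.mk '' G) = QuotientAddGroup.mk '' G := by
    ext q
    constructor
    · rintro ⟨_, ⟨g, hg, rfl⟩, rfl⟩; exact ⟨g, hg, (hF g).symm⟩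
    · rintro ⟨g, hg, rfl⟩; exact ⟨_, ⟨g, hg, rfl⟩, hF g⟩
  rw [← himg]
  refine Set.ncard_eq_mul_ncard_image_of_fiber ((hO.finite_image_mk_localAt R).subset
    (Set.image_mono hGΛ)) F (p ^ (4 * (R - 1))) ?_
  rintro b ⟨q, ⟨g₀, ⟨u₀, hu₀, rfl⟩, rfl⟩, rfl⟩
  have hfib : QuotientAddGroup.mk '' G ∩ F ⁻¹' {F (QuotientAddGroup.mk (u₀ : B))} =
      QuotientAddGroup.mk '' ((fun w : B => (u₀ : B) + w) '' (K₁ : Set B)) := by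
    ext q
    constructor
    · rintro ⟨⟨g, hg, rfl⟩, hq⟩
      rw [Set.mem_preimage, Set.mem_singleton_iff, hF, hF, QuotientAddGroup.eq] at hq
      refine ⟨g, ⟨g - u₀, ?_, by abel⟩, rfl⟩
      have : g - (u₀ : B) = -(-g + u₀) := by abel
      rw [SetLike.mem_coe, this]
      exact K₁.neg_mem hq
    · rintro ⟨_, ⟨w, hw, rfl⟩, rfl⟩
      obtain ⟨y, hy, rfl⟩ := (Submodule.mem_smul_pointwise_iff_exists w _ _).mp hw
      obtain ⟨u, hu, huval⟩ := hO.exists_stabilizer_eq_add_smul hu₀ hy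
      have hpy : ((p : ℤ) ^ 1) • y = (p : ℚ) • y := by
        rw [pow_one, ← natCast_zsmul_eq_ratCast_smul]
      refine ⟨⟨u, ⟨u, hu, rfl⟩, by rw [huval, hpy]⟩, ?_⟩
      rw [Set.mem_preimage, Set.mem_singleton_iff, hF, hF, QuotientAddGroup.eq]
      have : -((u₀ : B) + ((p : ℤ) ^ 1) • y) + u₀ = -(((p : ℤ) ^ 1) • y) := by abel
      rw [this]
      exact K₁.neg_mem hw
  rw [hfib, ncard_image_mk_add_left, show ((K₁ : Submodule ℤ B) : Set B) = (K₁.toAddSubgroup : Set B)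
    from rfl, ncard_image_mk_eq_relIndex, hKdef, hK₁def, hO.relIndex_pow_smul_smul hR]

omit [Algebra ℚ B] [IsQuaternionAlgebra ℚ B] hp hO in
/-- The size of a finite disjoint union indexed by `range R`. [folklore] -/
theorem Set.ncard_biUnion_range_of_disjoint {α : Type*} (s : ℕ → Set α) (R : ℕ)
    (hfin : ∀ k < R, (s k).Finite) (hdisj : ∀ k < R, ∀ k' < R, k ≠ k' → Disjoint (s k) (s k')) :
    (⋃ k ∈ Finset.range R, s k).ncard = ∑ k ∈ Finset.range R, (s k).ncard := by
  induction R with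
  | zero => simp
  | succ R ih =>
    have hfin' : ∀ k < R, (s k).Finite := fun k hk => hfin k (Nat.lt_succ_of_lt hk)
    have hdisj' : ∀ k < R, ∀ k' < R, k ≠ k' → Disjoint (s k) (s k') :=
      fun k hk k' hk' => hdisj k (Nat.lt_succ_of_lt hk) k' (Nat.lt_succ_of_lt hk')
    rw [Finset.sum_range_succ, ← ih hfin' hdisj', Finset.range_add_one, Finset.set_biUnion_insert,
      Set.union_comm, Set.ncard_union_eq ?_ ?_ (hfin R (Nat.lt_succ_self R))]
    · rw [Set.disjoint_iUnion₂_left]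
      exact fun k hk => hdisj k (Nat.lt_succ_of_lt (Finset.mem_range.mp hk)) R (Nat.lt_succ_self R)
        (Finset.mem_range.mp hk).ne
    · exact Set.Finite.biUnion (Finset.finite_toSet _) fun k hk => hfin' k (Finset.mem_range.mp hk)

/-- **Partition of `Λ / p^R Λ` by norm levels**: the `p^{4R}` classes of `Λ = O_(p)` modulo `p^R Λ`
split into the (pairwise disjoint) images of the norm-level sets `X_k`, `k < R`, and the image of the
rest `Y_R = Λ ∖ ⋃_{k<R} X_k` (for an order in a division algebra: `0` and the elements of norm
valuation `≥ R`). [folklore] -/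
theorem IsZOrder.pow_eq_sum_ncard_image_normLevel_add (R : ℕ) :
    p ^ (4 * R) = ∑ k ∈ Finset.range R, (QuotientAddGroup.mk '' (Units.val '' normLevelUnits p O k) :
        Set (B ⧸ (((p : ℤ) ^ R) • localAt p O).toAddSubgroup)).ncard +
      (QuotientAddGroup.mk '' ((localAt p O : Set B) \ ⋃ k ∈ Finset.range R,
          Units.val '' normLevelUnits p O k) :
        Set (B ⧸ (((p : ℤ) ^ R) • localAt p O).toAddSubgroup)).ncard := by
  classical
  set K : Submodule ℤ B := ((p : ℤ) ^ R) • localAt p O with hKdef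
  set A : ℕ → Set (B ⧸ K.toAddSubgroup) := fun k =>
    QuotientAddGroup.mk '' (Units.val '' normLevelUnits p O k) with hAdef
  set Y : Set B := (localAt p O : Set B) \ ⋃ k ∈ Finset.range R, Units.val '' normLevelUnits p O k
    with hYdef
  have hXΛ : ∀ k, Units.val '' normLevelUnits p O k ⊆ (localAt p O : Set B) := by
    rintro k _ ⟨z, hz, rfl⟩; exact hz.1
  have hfinΛ := hO.finite_image_mk_localAt (p := p) R
  have hfinA : ∀ k, (A k).Finite := fun k => hfinΛ.subset (Set.image_mono (hXΛ k))
  have hfinY : (QuotientAddGroup.mk '' Y : Set (B ⧸ K.toAddSubgroup)).Finite :=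
    hfinΛ.subset (Set.image_mono Set.sdiff_subset)
  -- congruent elements of `Λ` lie in the same `X_k` (`k < R`)
  have key : ∀ k < R, ∀ z ∈ normLevelUnits p O k, ∀ y ∈ localAt p O,
      (QuotientAddGroup.mk y : B ⧸ K.toAddSubgroup) = QuotientAddGroup.mk (z : B) →
        y ∈ Units.val '' normLevelUnits p O k := by
    intro k hk z hz y _ hyz
    rw [QuotientAddGroup.eq] at hyz
    have hsub : y - z ∈ K := by
      have : y - (z : B) = -(-y + z) := by abel
      rw [this]; exact K.neg_mem hyz
    obtain ⟨u, hu, rfl⟩ := hO.exists_eq_mul_of_sub_mem (by omega) hz hsub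
    exact ⟨z * u, hO.mul_mem_normLevelUnits hz hu, rfl⟩
  have hdisj : ∀ k < R, ∀ k' < R, k ≠ k' → Disjoint (A k) (A k') := by
    intro k hk k' hk' hkk'
    rw [Set.disjoint_left]
    rintro q ⟨_, ⟨z, hz, rfl⟩, rfl⟩ ⟨_, ⟨z', hz', rfl⟩, hq⟩
    obtain ⟨w, hw, hwz'⟩ := key k hk z hz z' hz'.1 hq
    have : w = z' := Units.ext hwz'
    subst this
    exact hkk' (normLevelUnits_disjoint hw hz')
  have hdisjY : Disjoint (⋃ k ∈ Finset.range R, A k) (QuotientAddGroup.mk '' Y) := by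
    rw [Set.disjoint_iUnion₂_left]
    intro k hk
    rw [Set.disjoint_left]
    rintro q ⟨_, ⟨z, hz, rfl⟩, rfl⟩ ⟨y, hy, hq⟩
    have hk' := Finset.mem_range.mp hk
    have hyX := key k hk' z hz y hy.1 hq
    exact hy.2 (Set.mem_biUnion hk hyX)
  -- `Λ mod K` is the union of the pieces
  have hunion : (QuotientAddGroup.mk '' (localAt p O : Set B) : Set (B ⧸ K.toAddSubgroup)) =
      (⋃ k ∈ Finset.range R, A k) ∪ QuotientAddGroup.mk '' Y := by
    apply le_antisymm
    · rintro q ⟨x, hx, rfl⟩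
      by_cases hxU : x ∈ ⋃ k ∈ Finset.range R, Units.val '' normLevelUnits p O k
      · left
        rw [Set.mem_iUnion₂] at hxU ⊢
        obtain ⟨k, hk, hxk⟩ := hxU
        exact ⟨k, hk, Set.mem_image_of_mem _ hxk⟩
      · right
        exact ⟨x, ⟨hx, hxU⟩, rfl⟩
    · apply Set.union_subset
      · exact Set.iUnion₂_subset fun k _ => Set.image_mono (hXΛ k)
      · exact Set.image_mono Set.sdiff_subset
  rw [← hO.ncard_image_mk_localAt R, hunion, Set.ncard_union_eq hdisjY
    (Set.Finite.biUnion (Finset.finite_toSet _) fun k _ => hfinA k) hfinY,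
    Set.ncard_biUnion_range_of_disjoint A R (fun k _ => hfinA k) hdisj]

end Reduction

end Literature.NumberTheory.Automorphic
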